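import Literature.MathematicalPhysics.QuantumFieldTheory.Balaban1983to89.B9ThmDCubePlateau
import Literature.MathematicalPhysics.QuantumFieldTheory.Balaban1983to89.B9Thm37CubeCoverCommutatorSizesGrad

/-!
# `Balaban1983to89.B9ThmDCommutatorStep` — THEOREM D FOR THE RECORD'S LETTERS, FILE D3: THE COMMUTATOR STEP `R_χ := [M_χ, Δ′_{a,□}(Ṽ_□)]·G′_□(Ṽ_□)` HAS A
# MEMBER-UNIFORM BLOCK MAJORANT `θ_R·e^{−δd}` OVER THE CUBE SEQUENCE'S BLOCKS, AND ITS ROWS VANISH ON THE PLATEAU `NearC(3S_j − L^{j+1})`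
# (sub-row G-B9-LETTERS, GAPS G-B9-05, file D3)

T. Bałaban, *Propagators for lattice gauge theories in a background field*, Commun. Math. Phys. **99** (1985) 389–434 [`Balaban1985BackgroundPropagators`, "[B9]"];
[4] = T. Bałaban, *Propagators and renormalization transformations for lattice gauge theories. II*, Commun. Math. Phys. **96** (1984) 223–250 [`Balaban1984PropagatorsII`];
[2] of [B9] = T. Bałaban, *Regularity and decay of lattice Green's functions*, Commun. Math. Phys. **89** (1983) 571–597 [`Balaban1983RegularityDecay`].

statement-level skeleton of published theorems with citation tags; proofs where landed; nothing here is a claim about the Yang–Mills mass gap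

THE PRINT (held `paper:balaban1985-cmp99-background-propagators`, journal page = PDF page + 388).  (3.88)–(3.89) p. 409: *«K(h_□) = h_□Δ′_a(U) − Δ′_a(U)h_□ … it is
a bounded operator with norm O(M⁻¹) when composed with G′_□»* (the mechanism); p. 412 l. 1–9, THEOREM D paragraph: *«the operators may differ outside □̃₀, and the
distance from □̃ to □̃₀ᶜ is at least M»*; the road of print for Theorem D is [2] Sect. 5 (5.8) p. 594 (a second random-walk expansion and cancellation of common
walks, (5.17)–(5.22) pp. 596–597).  LABELLED DEVIATION (cell RULINGS #7/#10 pattern; lead GO 15:21Z condition (b)): this file family proves THEOREM D for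
the record's letters WITHOUT the second expansion of [2] — by the commutator identity of file D1, the (3.89) mechanism for ONE plateau cut-off (this file),
the decay of the two letters and the `M`-gap of the cube geometry (file D4).  The estimate proved here is print's (3.89) line read at `Ṽ_□` with `χ_□` in place
of `h_□`: first order × `|∂χ_□| ≤ O(1)(ML^jη)⁻¹` against (3.42)₁, zeroth order × `|Δχ_□| ≤ O(1)(ML^jη)⁻²` against (3.42)₀ ([4] p. 247), the averaging line by
its block-locality (3.24)/(3.59).

WHAT THIS FILE PROVES (THEOREMS only; 0 `def`; 0 sorry).
* §1 dictionary: `coordSymm_conj`, ★ `norm_apply_le_of_hasMajorant` (a conj-b block majorant of `T` bounds `‖(TΛ)(x)‖` for a block-supported source).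
* §2 ★ `commStep_apply` — `([M_h, Δ′_{a,□}(V)]·G′_□(V))Λ = K_Δ(h)(Ψ) + (h·(AΨ) − A(hΨ))`, `Ψ = G′_□(V)Λ`, `A` = the averaging term of `Δ′_{a,□}(V)`, `K_Δ(h) = [M_h, Δ_V]`
  (p38's `cutCommY`); `avgCube_GpCubeY_apply` (`AΨ = Λ − Δ_VΨ` by `Δ′_{a,□}G′_□ = 1`).
* §3 ★ THE PLATEAU: `nearC_of_mem_stencilY'` (forward stencil step in the wide window), `chiY_eq_one_on_stencilY_of_nearC`, ★ `commStep_apply_eq_zero_of_nearC` — the rows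
  of `R_χ` inside `NearC(3S_j − L^{j+1})` VANISH (`χ_□ ≡ 1` on the whole stencil).
* §4 ★★★ `hasMajorant_conj_commStep` — from the four (3.42) entries of `G′_□(V)` in conj-b form over `geoCK` (p33 7b-C's output shape: `G ≺ B_f ℓ² e^{−δd}`,
  `∇_μG, ∇*_μG ≺ B_f ℓ e^{−δd}`, `η⁻²Δ_V·G ≺ B_L e^{−δd}`) and the (3.59) sizes of the averaging word at `V`:
  `conj b(R_χ) ≺ θ_R·e^{−δd}`, `θ_R = M₂Σ‖b‖·((d+1)B_f(D₁θ/2 + 3D₂θ/16) + 1 + B_L + (1 + C_qα₁)²B_f)` — MEMBER-UNIFORM (no `L^j`, no `η`).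

HONEST SCOPE.  Lattice units `η = (kGeo i).eta`; `𝔸` a complete normed `ℂ`-algebra with `‖1‖ ≤ 1`, real basis `b` with coordinate bound `M₂`; `V`, `par` arbitrary
(instantiated at `Ṽ_□`, `parSymY` in file D5); the entries are HYPOTHESES here (discharged by p33's `gp_cube_entries_at_locCfg` ∕ `gp_cube_at_locCfg` in D5).
Count-neutral; nothing continuum, nothing about OS axioms or the mass gap.  No `sorry`, no `axiom`, no `instance`, no `notation`.  NEW file.  Net new unproved
facts: 0.  Seat `lit-balaban-p21` gen 35, 2026-08-28; `--supports stmt-QuantumFields-19200`.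
-/

noncomputable section

namespace Literature.MathematicalPhysics.QuantumFieldTheory.Balaban1983to89.B9ThmDCommutatorStep

open B6RandomWalk (HasMajorant BlockSupp hasMajorant_mono)
open B9Thm34Ext (toB6)
open B6KLevelCensusIndexV1 (KIdx kGeo)
open B6Cover236MultiLevelBlocks (cubes)
open B6Geom246MultiLevelBox (blkOf)
open B9Eq352DivFormLetters (conj conj_apply conj_mul coordEquiv coordEquiv_apply norm_coordSymm_apply_le)
open B9Eq352GradLetters (diffLetter)
open B9Eq39Adjoint (R)
open B9Eq360DeltaPrimeACubeY (blkCubeY kFCubeY sFCubeY)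
open B9CubeLettersOpsL0 (deltaPrimeACubeY avgCoeffCubeY avgTrCubeY GpCubeY deltaPrimeACubeY_mul_GpCubeY)
open B9CubeLettersBondOpsL0 (BlkCubeY)
open B9CubeGeometryInputs (geoCK geoCK_eta geoCK_eta_pos geoCK_len_pos geoCK_dist_axioms)
open B9Cor35GpCubeInputsAtOne (wK)
open B9Cor36CubeTwinsGeometry (bS one_le_bS eight_mul_bS_le_SC)
open B9Cor36CubeCutoffs (SC NearC chiY chiY_eq_one_of_nearC one_le_SC nearC_shiftY nearC_shiftY_symm nearC_of_blkOf_eq levY_eq_of_blkOf_eq abs_chiY_le_one)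
open B9Cor36CutoffSecondDiff (chiY_weights)
open B9Cor36GpCubeLocLetter (deltaPrimeACubeY_apply_congr_stencil)
open B9Cor36GpCubeLocAtMember (diffLetter_inl_apply diffLetter_inr_apply)
open B9Cor36GpCubeEntriesAtV (norm_avgCube_apply_le hasMajorant_one_decay)
open B9Thm37CubeCoverCommutators (cutMulY cutMulY_apply cutCommY cutCommY_apply stencilY self_mem_stencilY)
open B9Thm37CubeCoverCommutatorSizes (norm_ofReal_smul)
open B9Thm37CubeCoverCommutatorSizesGrad (norm_cutCommY_lapSL_apply_le_grad)
open B9ThmDCubePlateau (pow_levY_le_bS')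
open B4PartitionUnity22 (thetaProf D1 D2 D1_nonneg D2_nonneg contDiff_thetaProf hasCompactSupport_thetaProf)
open Node00 (SiteY CfgY SiteParY toKT levY shiftY UboxY lapSL kernelTrOpY cdS cdsS cdS_smul cdsS_smul)

variable {d ℓ : ℕ} {hd : 1 ≤ d + 1} {hL : Odd (ℓ + 1) ∧ 1 < ℓ + 1} {b₀ b₁ : ℝ}
variable {𝔸 : Type} [NormedRing 𝔸] [NormedAlgebra ℂ 𝔸] [CompleteSpace 𝔸]
variable {ι : Type} [Fintype ι]

/-! ## §1 Dictionary: a conj-b block majorant bounds the `𝔸`-valued rows -/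

section Dictionary

variable (b : Module.Basis ι ℝ 𝔸) {S : Type}

omit [CompleteSpace 𝔸] in
/-- `coordEquiv⁻¹ ∘ conj b T = T ∘ coordEquiv⁻¹`. [cite: Balaban1984PropagatorsII, (2.51) p.232, dictionary] -/
theorem coordSymm_conj (T : Module.End ℝ (S → 𝔸)) (μ : S × ι → ℝ) : (coordEquiv b).symm (conj b T μ) = T ((coordEquiv b).symm μ) := by
  have e : conj b T μ = coordEquiv b (T ((coordEquiv b).symm μ)) := by
    funext p; rw [conj_apply, coordEquiv_apply]
  rw [e, LinearEquiv.symm_apply_apply]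

omit [CompleteSpace 𝔸] in
/-- ★ **A CONJ-b BLOCK MAJORANT BOUNDS THE ROWS**: if `conj b T ≺ K` (block map `blk ∘ fst`) and the real source `μ` is supported in the block `y′` with `|μ| ≤ B`,
then `‖(T coordEquiv⁻¹μ)(x)‖ ≤ Σ‖b_j‖·K(blk x, y′)·B`. [cite: Balaban1984PropagatorsII, (2.51) p.232; Balaban1985BackgroundPropagators, (3.39) p.397] -/
theorem norm_apply_le_of_hasMajorant {g : B6.Geometry} (blk : S → g.Site) {T : Module.End ℝ (S → 𝔸)} {K : g.Site → g.Site → ℝ}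
    (hT : HasMajorant (g := g) (fun p : S × ι => blk p.1) (conj b T) K) {y' : g.Site} {μ : S × ι → ℝ} {B : ℝ}
    (hμ : BlockSupp (g := g) (fun p : S × ι => blk p.1) μ y' B) (x : S) :
    ‖T ((coordEquiv b).symm μ) x‖ ≤ (∑ j, ‖b j‖) * (K (blk x) y' * B) := by
  rw [← coordSymm_conj]
  exact norm_coordSymm_apply_le b _ x _ fun j => hT y' μ B hμ (x, j)

end Dictionary

variable (i : KIdx d ℓ hd hL b₀ b₁) (c : ↥(cubes (toKT i).D.toDomains))

/-! ## §2 The commutator step, evaluated -/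

/-- ★ **`([M_h, Δ′_{a,□}(V)]·G′_□(V))Λ = K_Δ(h)Ψ + (h·(AΨ) − A(hΨ))`**, `Ψ = G′_□(V)Λ`, `A` the averaging term of r05's `Δ′_{a,□}(V) = Δ_V + A`, `K_Δ(h) = [M_h, Δ_V]`.
[cite: Balaban1985BackgroundPropagators, (3.88) p.409, (3.24) p.394] -/
theorem commStep_apply (par : SiteParY 𝔸 i) (V : CfgY 𝔸 i) (h : SiteY i → ℝ) (Λ : SiteY i → 𝔸) (z : SiteY i) :
    (((cutMulY h * deltaPrimeACubeY i c par V - deltaPrimeACubeY i c par V * cutMulY h) * GpCubeY i c par V :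
      Module.End ℂ (SiteY i → 𝔸)) Λ) z =
      cutCommY h (lapSL i V) (GpCubeY i c par V Λ) z +
        ((((h z : ℝ)) : ℂ) • kernelTrOpY (avgCoeffCubeY i c) (avgTrCubeY i c par V) (GpCubeY i c par V Λ) z -
          kernelTrOpY (avgCoeffCubeY i c) (avgTrCubeY i c par V) (cutMulY h (GpCubeY i c par V Λ)) z) := by
  rw [Module.End.mul_apply, LinearMap.sub_apply, Pi.sub_apply, Module.End.mul_apply, Module.End.mul_apply, cutMulY_apply, cutCommY_apply]
  simp only [deltaPrimeACubeY, LinearMap.add_apply, Pi.add_apply, smul_add]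
  abel

/-- `AΨ = Λ − Δ_VΨ` for `Ψ = G′_□(V)Λ` (`Δ′_{a,□}(V)G′_□(V) = 1`). [cite: Balaban1985BackgroundPropagators, (3.24)–(3.25) p.394, p.409 l.1–5] -/
theorem avgCube_GpCubeY_apply (par : SiteParY 𝔸 i) (V : CfgY 𝔸 i) (hunit : IsUnit (deltaPrimeACubeY i c par V)) (Λ : SiteY i → 𝔸) (z : SiteY i) :
    kernelTrOpY (avgCoeffCubeY i c) (avgTrCubeY i c par V) (GpCubeY i c par V Λ) z = Λ z - lapSL i V (GpCubeY i c par V Λ) z := by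
  have h1 : deltaPrimeACubeY i c par V (GpCubeY i c par V Λ) = Λ := by
    rw [← Module.End.mul_apply, deltaPrimeACubeY_mul_GpCubeY i c par V hunit, Module.End.one_apply]
  have h2 : deltaPrimeACubeY i c par V (GpCubeY i c par V Λ) z =
      lapSL i V (GpCubeY i c par V Λ) z + kernelTrOpY (avgCoeffCubeY i c) (avgTrCubeY i c par V) (GpCubeY i c par V Λ) z := by
    simp only [deltaPrimeACubeY, LinearMap.add_apply, Pi.add_apply]
  rw [h1] at h2
  rw [h2]; abel

/-! ## §3 The plateau: the rows of `R_χ` inside `NearC(3S_j − L^{j+1})` vanish -/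

/-- the forward stencil step in the wide window: `z` within `r ≤ 4S_j`, `w ∈ stencil(z)` ⟹ `w` within `r + L^{j+1}`. [cite: Balaban1985BackgroundPropagators, (3.88) p.409, p.408] -/
theorem nearC_of_mem_stencilY' {r : ℤ} (hr : r ≤ 4 * SC i c) {z w : SiteY i} (hz : NearC i c r z.1) (hmem : w ∈ stencilY i z) :
    NearC i c (r + (bS i c : ℤ)) w.1 := by
  have hb' : (1 : ℤ) ≤ (bS i c : ℤ) := by exact_mod_cast one_le_bS i c
  unfold stencilY at hmem
  simp only [Finset.mem_union, Finset.mem_singleton, Finset.mem_image, Finset.mem_univ, true_and, Finset.mem_filter] at hmem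
  rcases hmem with ((rfl | ⟨μ, rfl⟩) | ⟨μ, rfl⟩) | hmem
  · exact hz.mono i c (by linarith)
  · exact (nearC_shiftY i c hz μ).mono i c (by linarith)
  · exact (nearC_shiftY_symm i c hz μ).mono i c (by linarith)
  · have hbl : blkOf (toKT i).D.toDomains w = blkOf (toKT i).D.toDomains z := by
      rw [B9Thm311DeltaPrimeSymm.avgCoeffY_eq_ite] at hmem
      by_contra hne; exact hmem (if_neg hne)
    have h1 := nearC_of_blkOf_eq i c hbl.symm hz
    have hp := pow_levY_le_bS' i c hr hz
    rw [← levY_eq_of_blkOf_eq i hbl] at hp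
    exact h1.mono i c (by linarith)

/-- `χ_□ ≡ 1` on the stencil of a row inside `NearC(3S_j − L^{j+1})`. [cite: Balaban1985BackgroundPropagators, (3.88) p.409; Balaban1984PropagatorsI, (1.118) p.36] -/
theorem chiY_eq_one_on_stencilY_of_nearC {z : SiteY i} (hz : NearC i c (3 * SC i c - (bS i c : ℤ)) z.1) : ∀ w ∈ stencilY i z, chiY i c w = 1 := by
  intro w hw
  have h8 := eight_mul_bS_le_SC i c
  have hb' : (1 : ℤ) ≤ (bS i c : ℤ) := by exact_mod_cast one_le_bS i c
  exact chiY_eq_one_of_nearC i c (by linarith) (nearC_of_mem_stencilY' i c (by linarith) hz hw)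

/-- ★ **THE ROWS OF `[M_χ, Δ′_{a,□}(V)]` INSIDE THE PLATEAU VANISH**: `χ_□ ≡ 1` on the whole stencil of the row. [cite: Balaban1985BackgroundPropagators, (3.88) p.409, p.412 l.1–9] -/
theorem comm_cutMulY_chiY_apply_eq_zero_of_nearC (par : SiteParY 𝔸 i) (V : CfgY 𝔸 i) (X : SiteY i → 𝔸) {z : SiteY i}
    (hz : NearC i c (3 * SC i c - (bS i c : ℤ)) z.1) :
    ((cutMulY (chiY i c) * deltaPrimeACubeY i c par V - deltaPrimeACubeY i c par V * cutMulY (chiY i c) : Module.End ℂ (SiteY i → 𝔸)) X) z = 0 := by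
  have h1 : ∀ w ∈ stencilY i z, cutMulY (chiY i c) X w = X w := fun w hw => by
    rw [cutMulY_apply, chiY_eq_one_on_stencilY_of_nearC i c hz w hw, Complex.ofReal_one, one_smul]
  have hz1 : chiY i c z = 1 := chiY_eq_one_on_stencilY_of_nearC i c hz z (self_mem_stencilY i z)
  rw [LinearMap.sub_apply, Pi.sub_apply, Module.End.mul_apply, Module.End.mul_apply, cutMulY_apply, hz1, Complex.ofReal_one, one_smul,
    deltaPrimeACubeY_apply_congr_stencil i c par V z h1, sub_self]

/-- ★ hence the rows of `R_χ = [M_χ, Δ′_{a,□}(V)]·G′_□(V)` inside the plateau vanish. [cite: Balaban1985BackgroundPropagators, (3.88) p.409, p.412 l.1–9] -/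
theorem commStep_apply_eq_zero_of_nearC (par : SiteParY 𝔸 i) (V : CfgY 𝔸 i) (Λ : SiteY i → 𝔸) {z : SiteY i} (hz : NearC i c (3 * SC i c - (bS i c : ℤ)) z.1) :
    (((cutMulY (chiY i c) * deltaPrimeACubeY i c par V - deltaPrimeACubeY i c par V * cutMulY (chiY i c)) * GpCubeY i c par V :
      Module.End ℂ (SiteY i → 𝔸)) Λ) z = 0 := by
  rw [Module.End.mul_apply]
  exact comm_cutMulY_chiY_apply_eq_zero_of_nearC i c par V _ hz

/-! ## §4 ★★★ The member-uniform block majorant of `conj b(R_χ)` over the cube sequence's blocks -/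

section Main

variable (b : Module.Basis ι ℝ 𝔸)

/-- ★★★ **THE COMMUTATOR STEP `R_χ = [M_χ, Δ′_{a,□}(V)]·G′_□(V)` HAS THE MEMBER-UNIFORM BLOCK MAJORANT `θ_R·e^{−δd}`** over the cube sequence's blocks (`geoCK`,
block map `blkCubeY`), from the (3.42) entries of `G′_□(V)` in conj-b form — `G = conj b(η²G′) ≺ B_fℓ²e^{−δd}`, `conj b(η⁻¹∇_μ)G, conj b(−η⁻¹∇*_μ)G ≺ B_fℓe^{−δd}`,
`conj b(η⁻²Δ_V)G ≺ B_Le^{−δd}` — and the (3.59) sizes of the averaging word of `Δ′_{a,□}(V)`: print's (3.89) line for the plateau cut-off `χ_□` (`|η⁻¹∂χ_□|ℓ ≤ D₁θ/4`,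
`|η⁻²∂∂*χ_□|ℓ² ≤ 3D₂θ/16`, [4] p. 247). [cite: Balaban1985BackgroundPropagators, (3.88)–(3.89) p.409, Thm 3.1 (3.42) p.397, (3.24) p.394, (3.59) p.402; Balaban1984PropagatorsII, p.247, (2.51)–(2.52) p.232] -/
theorem hasMajorant_conj_commStep {M₂ : ℝ} (hM₂ : 0 ≤ M₂) (hrepr : ∀ (v : 𝔸) (j : ι), |b.repr v j| ≤ M₂ * ‖v‖) (h1A : ‖(1 : 𝔸)‖ ≤ 1)
    (Rr : ℝ) (H : Prop) (par : SiteParY 𝔸 i) (hpar : ∀ z w, par (fun _ _ => 1) z w = 1) (V : CfgY 𝔸 i) (hunit : IsUnit (deltaPrimeACubeY i c par V))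
    {δ Bf BL Cq α₁ : ℝ} (hBf : 0 ≤ Bf) (hCq : 0 ≤ Cq) (hα : 0 ≤ α₁)
    (hkF : ∀ (y : BlkCubeY i c) (x : SiteY i), blkCubeY i c x = y → ‖kFCubeY i c par (fun _ _ => 1) V y x‖ ≤ Cq * α₁ * wK i c y)
    (hsF : ∀ x : SiteY i, ‖sFCubeY i c par (fun _ _ => 1) V x‖ ≤ Cq * α₁)
    (hG : HasMajorant (g := toB6 (geoCK i c) Rr H) (fun p : SiteY i × ι => blkCubeY i c p.1)
      (conj b (((kGeo i).eta ^ 2) • (GpCubeY i c par V).restrictScalars ℝ))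
      (fun a a' => Bf * (geoCK i c).len a ^ 2 * Real.exp (-(δ * (geoCK i c).dist a a'))))
    (hDf : ∀ μ : Fin (d + 1), HasMajorant (g := toB6 (geoCK i c) Rr H) (fun p : SiteY i × ι => blkCubeY i c p.1)
      (conj b (diffLetter (shiftY i) (UboxY i V) ((((kGeo i).eta : ℂ))⁻¹) (Sum.inl μ)) * conj b (((kGeo i).eta ^ 2) • (GpCubeY i c par V).restrictScalars ℝ))
      (fun a a' => Bf * (geoCK i c).len a * Real.exp (-(δ * (geoCK i c).dist a a'))))
    (hDb : ∀ μ : Fin (d + 1), HasMajorant (g := toB6 (geoCK i c) Rr H) (fun p : SiteY i × ι => blkCubeY i c p.1)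
      (conj b (diffLetter (shiftY i) (UboxY i V) ((((kGeo i).eta : ℂ))⁻¹) (Sum.inr μ)) * conj b (((kGeo i).eta ^ 2) • (GpCubeY i c par V).restrictScalars ℝ))
      (fun a a' => Bf * (geoCK i c).len a * Real.exp (-(δ * (geoCK i c).dist a a'))))
    (hLG : HasMajorant (g := toB6 (geoCK i c) Rr H) (fun p : SiteY i × ι => blkCubeY i c p.1)
      (conj b ((((kGeo i).eta ^ 2)⁻¹ : ℝ) • (lapSL i V).restrictScalars ℝ) * conj b (((kGeo i).eta ^ 2) • (GpCubeY i c par V).restrictScalars ℝ))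
      (fun a a' => BL * Real.exp (-(δ * (geoCK i c).dist a a')))) :
    HasMajorant (g := toB6 (geoCK i c) Rr H) (fun p : SiteY i × ι => blkCubeY i c p.1)
      (conj b (((cutMulY (chiY i c) * deltaPrimeACubeY i c par V - deltaPrimeACubeY i c par V * cutMulY (chiY i c)) * GpCubeY i c par V).restrictScalars ℝ))
      (fun a a' => M₂ * (∑ j, ‖b j‖) * (((d : ℝ) + 1) * Bf * (D1 thetaProf / 2 + 3 * D2 thetaProf / 16) + 1 + BL + (1 + Cq * α₁) ^ 2 * Bf) *
        Real.exp (-(δ * (geoCK i c).dist a a'))) := by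
  have hD1 := D1_nonneg contDiff_thetaProf hasCompactSupport_thetaProf
  have hD2 := D2_nonneg contDiff_thetaProf hasCompactSupport_thetaProf
  intro y' μ B hμ p
  have hB : 0 ≤ B := hμ.nonneg
  set η : ℝ := (kGeo i).eta with hηdef
  have hη : 0 < η := by rw [hηdef, ← geoCK_eta i c]; exact geoCK_eta_pos i c
  set Sb : ℝ := ∑ j, ‖b j‖ with hSbdef
  have hSb : 0 ≤ Sb := Finset.sum_nonneg fun _ _ => norm_nonneg _
  set Λ : SiteY i → 𝔸 := (coordEquiv b).symm μ with hΛdef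
  set Ψ : SiteY i → 𝔸 := GpCubeY i c par V Λ with hΨdef
  set lz : ℝ := (geoCK i c).len (blkCubeY i c p.1) with hlzdef
  have hlz : 0 < lz := geoCK_len_pos i c _
  set E : ℝ := Real.exp (-(δ * (geoCK i c).dist (blkCubeY i c p.1) y')) with hEdef
  set P : ℝ := Sb * B * E with hPdef
  have hP : 0 ≤ P := by positivity
  -- scalar bookkeeping
  have e1 : ((((η ^ 2)⁻¹ : ℝ)) : ℂ) * (((η ^ 2 : ℝ)) : ℂ) = 1 := by
    rw [← Complex.ofReal_mul, inv_mul_cancel₀ (by positivity), Complex.ofReal_one]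
  have en : ‖((η : ℂ))⁻¹ * (((η ^ 2 : ℝ)) : ℂ)‖ = η := by
    rw [← Complex.ofReal_inv, ← Complex.ofReal_mul, Complex.norm_real, Real.norm_eq_abs, abs_of_pos (by positivity)]
    field_simp
  -- the letter `η²G′Λ = η²•Ψ`
  have hGscΛ : ((η ^ 2 : ℝ) • (GpCubeY i c par V).restrictScalars ℝ) Λ = (((η ^ 2 : ℝ)) : ℂ) • Ψ := by
    rw [LinearMap.smul_apply, LinearMap.restrictScalars_apply, Complex.coe_smul]
  -- (0) `‖η²Ψ(x)‖ ≤ Σ‖b‖·B_f ℓ(x)² e B`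
  have h0 : ∀ x, ‖((((η ^ 2 : ℝ)) : ℂ) • Ψ) x‖ ≤ Sb * (Bf * (geoCK i c).len (blkCubeY i c x) ^ 2 *
      Real.exp (-(δ * (geoCK i c).dist (blkCubeY i c x) y')) * B) := fun x => by
    have h := norm_apply_le_of_hasMajorant (g := toB6 (geoCK i c) Rr H) b (blkCubeY i c) hG hμ x
    rwa [hGscΛ] at h
  have hΨz : ‖Ψ p.1‖ * η ^ 2 ≤ Bf * lz ^ 2 * P := by
    have h := h0 p.1
    rw [Pi.smul_apply, norm_ofReal_smul, abs_of_pos (pow_pos hη 2)] at h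
    calc ‖Ψ p.1‖ * η ^ 2 = η ^ 2 * ‖Ψ p.1‖ := mul_comm _ _
      _ ≤ _ := h
      _ = Bf * lz ^ 2 * P := by rw [hPdef]; ring
  -- (1) the forward derivative `η‖∇_νΨ(z)‖ ≤ B_f ℓ_z P`
  have hcd : ∀ ν, η * ‖cdS i V ν Ψ p.1‖ ≤ Bf * lz * P := fun ν => by
    have hT := hDf ν
    rw [← B9Eq352DivFormLetters.conj_mul] at hT
    have h := norm_apply_le_of_hasMajorant (g := toB6 (geoCK i c) Rr H) b (blkCubeY i c) hT hμ p.1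
    rw [Module.End.mul_apply, hGscΛ, diffLetter_inl_apply, cdS_smul, Pi.smul_apply, smul_smul, norm_smul, en] at h
    calc η * ‖cdS i V ν Ψ p.1‖ ≤ _ := h
      _ = Bf * lz * P := by rw [hPdef]; ring
  -- (2) the backward derivative `η‖∇*_νΨ(z)‖ ≤ B_f ℓ_z P`
  have hcds : ∀ ν, η * ‖cdsS i V ν Ψ p.1‖ ≤ Bf * lz * P := fun ν => by
    have hT := hDb ν
    rw [← B9Eq352DivFormLetters.conj_mul] at hT
    have h := norm_apply_le_of_hasMajorant (g := toB6 (geoCK i c) Rr H) b (blkCubeY i c) hT hμ p.1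
    rw [Module.End.mul_apply, hGscΛ, diffLetter_inr_apply, cdsS_smul, Pi.neg_apply, Pi.smul_apply, Pi.smul_apply, smul_smul, norm_neg, norm_smul,
      en] at h
    calc η * ‖cdsS i V ν Ψ p.1‖ ≤ _ := h
      _ = Bf * lz * P := by rw [hPdef]; ring
  -- (3) the Laplacian `‖Δ_VΨ(z)‖ ≤ B_L P`
  have hlap : ‖lapSL i V Ψ p.1‖ ≤ BL * P := by
    have hT := hLG
    rw [← B9Eq352DivFormLetters.conj_mul] at hT
    have h := norm_apply_le_of_hasMajorant (g := toB6 (geoCK i c) Rr H) b (blkCubeY i c) hT hμ p.1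
    rw [Module.End.mul_apply, hGscΛ, LinearMap.smul_apply, LinearMap.restrictScalars_apply, map_smul, Pi.smul_apply, Pi.smul_apply,
      ← Complex.coe_smul, smul_smul, e1, one_smul] at h
    calc ‖lapSL i V Ψ p.1‖ ≤ _ := h
      _ = BL * P := by rw [hPdef]; ring
  -- (4) the source `‖Λ(z)‖ ≤ P`
  have hΛz : ‖Λ p.1‖ ≤ P := by
    have h1 := hasMajorant_one_decay i c Rr H (fun q : SiteY i × ι => blkCubeY i c q.1) δ
    rw [show (1 : Module.End ℝ (SiteY i × ι → ℝ)) = conj b (1 : Module.End ℝ (SiteY i → 𝔸)) from (LinearEquiv.conj_id _).symm] at h1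
    have h := norm_apply_le_of_hasMajorant (g := toB6 (geoCK i c) Rr H) b (blkCubeY i c) h1 hμ p.1
    rw [Module.End.one_apply] at h
    calc ‖Λ p.1‖ ≤ _ := h
      _ = P := by rw [hPdef]; ring
  -- (5) the averaging line, first piece `‖χ(z)(AΨ)(z)‖ ≤ (1 + B_L)P`
  have hA1 : ‖(((chiY i c p.1 : ℝ)) : ℂ) • kernelTrOpY (avgCoeffCubeY i c) (avgTrCubeY i c par V) Ψ p.1‖ ≤ (1 + BL) * P := by
    rw [norm_ofReal_smul, avgCube_GpCubeY_apply i c par V hunit]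
    calc |chiY i c p.1| * ‖Λ p.1 - lapSL i V Ψ p.1‖ ≤ 1 * (‖Λ p.1‖ + ‖lapSL i V Ψ p.1‖) :=
          mul_le_mul (abs_chiY_le_one i c p.1).1 (norm_sub_le _ _) (norm_nonneg _) zero_le_one
      _ ≤ (1 + BL) * P := by rw [one_mul]; linarith
  -- (6) the averaging line, second piece `‖(A(χΨ))(z)‖ ≤ (1 + C_qα₁)²B_f P` (block-locality of the averaging word)
  have hA2 : ‖kernelTrOpY (avgCoeffCubeY i c) (avgTrCubeY i c par V) (cutMulY (chiY i c) Ψ) p.1‖ ≤ (1 + Cq * α₁) ^ 2 * Bf * P := by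
    have hBf' : ∀ x', blkCubeY i c x' = blkCubeY i c p.1 → ‖cutMulY (chiY i c) ((((η ^ 2 : ℝ)) : ℂ) • Ψ) x'‖ ≤ Sb * (Bf * lz ^ 2 * E * B) := by
      intro x' hx'
      rw [cutMulY_apply, norm_ofReal_smul]
      have h := h0 x'
      rw [hx'] at h
      calc |chiY i c x'| * ‖((((η ^ 2 : ℝ)) : ℂ) • Ψ) x'‖ ≤ 1 * ‖((((η ^ 2 : ℝ)) : ℂ) • Ψ) x'‖ :=
            mul_le_mul_of_nonneg_right (abs_chiY_le_one i c x').1 (norm_nonneg _)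
        _ ≤ _ := by rw [one_mul]; exact h
    have hA := norm_avgCube_apply_le i c par h1A hpar V hCq hα hkF hsF (cutMulY (chiY i c) ((((η ^ 2 : ℝ)) : ℂ) • Ψ)) p.1 _ hBf'
    rw [LinearMap.smul_apply, LinearMap.restrictScalars_apply, map_smul (cutMulY (𝔸 := 𝔸) (chiY i c)), map_smul, Pi.smul_apply, Pi.smul_apply,
      ← Complex.coe_smul, smul_smul, e1, one_smul] at hA
    calc ‖kernelTrOpY (avgCoeffCubeY i c) (avgTrCubeY i c par V) (cutMulY (chiY i c) Ψ) p.1‖ ≤ _ := hA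
      _ = (1 + Cq * α₁) ^ 2 * Bf * P * ((((geoCK i c).len (blkCubeY i c p.1)) ^ 2)⁻¹ * lz ^ 2) := by rw [hPdef]; ring
      _ = (1 + Cq * α₁) ^ 2 * Bf * P := by rw [hlzdef, inv_mul_cancel₀ (pow_ne_zero 2 (geoCK_len_pos i c _).ne'), mul_one]
  -- (7) the weights of the plateau cut-off against (1), (2), (0)
  have hw1 : ∀ ν, |chiY i c (shiftY i ν p.1) - chiY i c p.1| * ‖cdS i V ν Ψ p.1‖ ≤ D1 thetaProf / 4 * (Bf * P) := fun ν => by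
    have h4 := (chiY_weights i c ν p.1).2.2.2.1
    have e : |chiY i c (shiftY i ν p.1) - chiY i c p.1| * ‖cdS i V ν Ψ p.1‖ =
        |η⁻¹ * (chiY i c (shiftY i ν p.1) - chiY i c p.1)| * (η * ‖cdS i V ν Ψ p.1‖) := by
      rw [abs_mul, abs_inv, abs_of_pos hη]; field_simp
    rw [e]
    calc |η⁻¹ * (chiY i c (shiftY i ν p.1) - chiY i c p.1)| * (η * ‖cdS i V ν Ψ p.1‖)
        ≤ |η⁻¹ * (chiY i c (shiftY i ν p.1) - chiY i c p.1)| * (Bf * lz * P) := mul_le_mul_of_nonneg_left (hcd ν) (abs_nonneg _)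
      _ = |η⁻¹ * (chiY i c (shiftY i ν p.1) - chiY i c p.1)| * lz * (Bf * P) := by ring
      _ ≤ D1 thetaProf / 4 * (Bf * P) := mul_le_mul_of_nonneg_right h4 (by positivity)
  have hw2 : ∀ ν, |chiY i c ((shiftY i ν).symm p.1) - chiY i c p.1| * ‖cdsS i V ν Ψ p.1‖ ≤ D1 thetaProf / 4 * (Bf * P) := fun ν => by
    have h5 := (chiY_weights i c ν p.1).2.2.2.2.1
    have e : |chiY i c ((shiftY i ν).symm p.1) - chiY i c p.1| * ‖cdsS i V ν Ψ p.1‖ =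
        |η⁻¹ * (chiY i c ((shiftY i ν).symm p.1) - chiY i c p.1)| * (η * ‖cdsS i V ν Ψ p.1‖) := by
      rw [abs_mul, abs_inv, abs_of_pos hη]; field_simp
    rw [e]
    calc |η⁻¹ * (chiY i c ((shiftY i ν).symm p.1) - chiY i c p.1)| * (η * ‖cdsS i V ν Ψ p.1‖)
        ≤ |η⁻¹ * (chiY i c ((shiftY i ν).symm p.1) - chiY i c p.1)| * (Bf * lz * P) := mul_le_mul_of_nonneg_left (hcds ν) (abs_nonneg _)
      _ = |η⁻¹ * (chiY i c ((shiftY i ν).symm p.1) - chiY i c p.1)| * lz * (Bf * P) := by ring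
      _ ≤ D1 thetaProf / 4 * (Bf * P) := mul_le_mul_of_nonneg_right h5 (by positivity)
  have hw3 : |∑ ν : Fin (d + 1), (chiY i c (shiftY i ν p.1) + chiY i c ((shiftY i ν).symm p.1) - 2 * chiY i c p.1)| * ‖Ψ p.1‖ ≤
      ((d : ℝ) + 1) * (3 * D2 thetaProf / 16) * (Bf * P) := by
    have hterm : ∀ ν : Fin (d + 1), |chiY i c (shiftY i ν p.1) + chiY i c ((shiftY i ν).symm p.1) - 2 * chiY i c p.1| * ‖Ψ p.1‖ ≤
        3 * D2 thetaProf / 16 * (Bf * P) := fun ν => by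
      have h6 := (chiY_weights i c ν p.1).2.2.2.2.2
      have er : chiY i c (shiftY i ν p.1) + chiY i c ((shiftY i ν).symm p.1) - 2 * chiY i c p.1 =
          chiY i c (shiftY i ν p.1) - 2 * chiY i c p.1 + chiY i c ((shiftY i ν).symm p.1) := by ring
      have e : |chiY i c (shiftY i ν p.1) - 2 * chiY i c p.1 + chiY i c ((shiftY i ν).symm p.1)| * ‖Ψ p.1‖ =
          |(η ^ 2)⁻¹ * (chiY i c (shiftY i ν p.1) - 2 * chiY i c p.1 + chiY i c ((shiftY i ν).symm p.1))| * (‖Ψ p.1‖ * η ^ 2) := by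
        rw [abs_mul, abs_inv, abs_of_pos (pow_pos hη 2)]; field_simp
      rw [er, e]
      calc |(η ^ 2)⁻¹ * (chiY i c (shiftY i ν p.1) - 2 * chiY i c p.1 + chiY i c ((shiftY i ν).symm p.1))| * (‖Ψ p.1‖ * η ^ 2)
          ≤ |(η ^ 2)⁻¹ * (chiY i c (shiftY i ν p.1) - 2 * chiY i c p.1 + chiY i c ((shiftY i ν).symm p.1))| * (Bf * lz ^ 2 * P) :=
            mul_le_mul_of_nonneg_left hΨz (abs_nonneg _)
        _ = |(η ^ 2)⁻¹ * (chiY i c (shiftY i ν p.1) - 2 * chiY i c p.1 + chiY i c ((shiftY i ν).symm p.1))| * lz ^ 2 * (Bf * P) := by ring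
        _ ≤ 3 * D2 thetaProf / 16 * (Bf * P) := mul_le_mul_of_nonneg_right h6 (by positivity)
    calc |∑ ν : Fin (d + 1), (chiY i c (shiftY i ν p.1) + chiY i c ((shiftY i ν).symm p.1) - 2 * chiY i c p.1)| * ‖Ψ p.1‖
        ≤ (∑ ν : Fin (d + 1), |chiY i c (shiftY i ν p.1) + chiY i c ((shiftY i ν).symm p.1) - 2 * chiY i c p.1|) * ‖Ψ p.1‖ :=
          mul_le_mul_of_nonneg_right (Finset.abs_sum_le_sum_abs _ _) (norm_nonneg _)
      _ = ∑ ν : Fin (d + 1), |chiY i c (shiftY i ν p.1) + chiY i c ((shiftY i ν).symm p.1) - 2 * chiY i c p.1| * ‖Ψ p.1‖ := Finset.sum_mul _ _ _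
      _ ≤ ∑ _ν : Fin (d + 1), 3 * D2 thetaProf / 16 * (Bf * P) := Finset.sum_le_sum fun ν _ => hterm ν
      _ = ((d : ℝ) + 1) * (3 * D2 thetaProf / 16) * (Bf * P) := by
          rw [Finset.sum_const, Finset.card_univ, Fintype.card_fin, nsmul_eq_mul]; push_cast; ring
  -- (8) the (3.88) first line, sized (p38), and the assembly
  have hK := norm_cutCommY_lapSL_apply_le_grad i V (chiY i c) Ψ p.1
  have hfirst : (∑ ν : Fin (d + 1), (|chiY i c (shiftY i ν p.1) - chiY i c p.1| * ‖cdS i V ν Ψ p.1‖ +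
      |chiY i c ((shiftY i ν).symm p.1) - chiY i c p.1| * ‖cdsS i V ν Ψ p.1‖)) ≤ ((d : ℝ) + 1) * (D1 thetaProf / 2) * (Bf * P) := by
    calc (∑ ν : Fin (d + 1), (|chiY i c (shiftY i ν p.1) - chiY i c p.1| * ‖cdS i V ν Ψ p.1‖ +
          |chiY i c ((shiftY i ν).symm p.1) - chiY i c p.1| * ‖cdsS i V ν Ψ p.1‖))
        ≤ ∑ _ν : Fin (d + 1), (D1 thetaProf / 4 * (Bf * P) + D1 thetaProf / 4 * (Bf * P)) := Finset.sum_le_sum fun ν _ => add_le_add (hw1 ν) (hw2 ν)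
      _ = ((d : ℝ) + 1) * (D1 thetaProf / 2) * (Bf * P) := by
          rw [Finset.sum_const, Finset.card_univ, Fintype.card_fin, nsmul_eq_mul]; push_cast; ring
  have hR : ‖(((cutMulY (chiY i c) * deltaPrimeACubeY i c par V - deltaPrimeACubeY i c par V * cutMulY (chiY i c)) * GpCubeY i c par V :
      Module.End ℂ (SiteY i → 𝔸)) Λ) p.1‖ ≤ Sb * (((d : ℝ) + 1) * Bf * (D1 thetaProf / 2 + 3 * D2 thetaProf / 16) + 1 + BL + (1 + Cq * α₁) ^ 2 * Bf) *
        (E * B) := by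
    rw [commStep_apply i c par V (chiY i c) Λ p.1]
    calc ‖cutCommY (chiY i c) (lapSL i V) Ψ p.1 +
          ((((chiY i c p.1 : ℝ)) : ℂ) • kernelTrOpY (avgCoeffCubeY i c) (avgTrCubeY i c par V) Ψ p.1 -
            kernelTrOpY (avgCoeffCubeY i c) (avgTrCubeY i c par V) (cutMulY (chiY i c) Ψ) p.1)‖
        ≤ ‖cutCommY (chiY i c) (lapSL i V) Ψ p.1‖ +
          (‖(((chiY i c p.1 : ℝ)) : ℂ) • kernelTrOpY (avgCoeffCubeY i c) (avgTrCubeY i c par V) Ψ p.1‖ +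
            ‖kernelTrOpY (avgCoeffCubeY i c) (avgTrCubeY i c par V) (cutMulY (chiY i c) Ψ) p.1‖) :=
          (norm_add_le _ _).trans (add_le_add le_rfl (norm_sub_le _ _))
      _ ≤ (((d : ℝ) + 1) * (D1 thetaProf / 2) * (Bf * P) + ((d : ℝ) + 1) * (3 * D2 thetaProf / 16) * (Bf * P)) +
          ((1 + BL) * P + (1 + Cq * α₁) ^ 2 * Bf * P) := add_le_add (hK.trans (add_le_add hfirst hw3)) (add_le_add hA1 hA2)
      _ = Sb * (((d : ℝ) + 1) * Bf * (D1 thetaProf / 2 + 3 * D2 thetaProf / 16) + 1 + BL + (1 + Cq * α₁) ^ 2 * Bf) * (E * B) := by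
          rw [hPdef]; ring
  -- conclusion: `|b-coordinate| ≤ M₂‖·‖`
  rw [conj_apply, LinearMap.restrictScalars_apply]
  calc |b.repr ((((cutMulY (chiY i c) * deltaPrimeACubeY i c par V - deltaPrimeACubeY i c par V * cutMulY (chiY i c)) *
        GpCubeY i c par V : Module.End ℂ (SiteY i → 𝔸)) Λ) p.1) p.2|
      ≤ M₂ * ‖(((cutMulY (chiY i c) * deltaPrimeACubeY i c par V - deltaPrimeACubeY i c par V * cutMulY (chiY i c)) *
        GpCubeY i c par V : Module.End ℂ (SiteY i → 𝔸)) Λ) p.1‖ := hrepr _ _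
    _ ≤ M₂ * (Sb * (((d : ℝ) + 1) * Bf * (D1 thetaProf / 2 + 3 * D2 thetaProf / 16) + 1 + BL + (1 + Cq * α₁) ^ 2 * Bf) * (E * B)) :=
        mul_le_mul_of_nonneg_left hR hM₂
    _ = M₂ * Sb * (((d : ℝ) + 1) * Bf * (D1 thetaProf / 2 + 3 * D2 thetaProf / 16) + 1 + BL + (1 + Cq * α₁) ^ 2 * Bf) * E * B := by ring

end Main

end Literature.MathematicalPhysics.QuantumFieldTheory.Balaban1983to89.B9ThmDCommutatorStep

end
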